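import Summits.ResolutionOfSingularities.ResolutionOfSingularities.Theorems.FrobeniusClosingSteerToricUnitExitKTX
import Summits.ResolutionOfSingularities.ResolutionOfSingularities.Theorems.FrobeniusClosingSteerHevLeafMaxNoDropRecut

/-!
# Crux `Steer` (stmt-ResolutionOfSingularities-16345) — K-TX BY NAME: `ToricUnitExit.UnitDominantMonomialConclTwo` holds

OURS; NOT a statement of H. Hironaka's manuscript [claim: Hironaka2017, status: under-review]. RULING 305(a) glue (res-L0-w41-tri-1 BY-NAME
PRE-CHECK, TRIAGE v6.69): the tree's one-proposition reading of K-TX, `ToricUnitExit.UnitDominantMonomialConclTwo`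
(`…HevLeafMaxNoDropRecut`, binder for binder res-L0-w41-strat-1's signature), is inhabited by
`SteerToricUnitExit.concl_of_unit_dominant_monomial` (`…ToricUnitExitKTX`); the only delta is the extra `IsLocalRing (R N)` binder of the def,
which the theorem does not need (implied by `IsRegularLocalRing`, a `Prop`-class — proof-irrelevant).
-/

noncomputable section

-- single-problem summit: the doubled namespace component `ResolutionOfSingularities` is forced
set_option linter.dupNamespace false

namespace Summit.ResolutionOfSingularities.ResolutionOfSingularities.Theorems.SwitchingDichotomy.ToricUnitExit

/-- **K-TX holds** (the binder `hKTX : ToricUnitExit.UnitDominantMonomialConclTwo` of the W4.1 feeders is discharged by this name). OURS.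
[cite: NovacoskiSpivakovsky2014, Def. 2.8] -/
theorem unitDominantMonomialConclTwo_holds : UnitDominantMonomialConclTwo := by
  intro k K _ _ _ _ O A₀ h₀ t hfg hfr R hR0 s N hs0 hstep _ hreg hRO hcen n m y hy hn g w hw a M hodd E heq hdom
  exact SteerToricUnitExit.concl_of_unit_dominant_monomial O A₀ h₀ t hfg hfr R hR0 s N hs0 hstep hreg hRO hcen y hy hn g w hw a
    M hodd E heq hdom

end Summit.ResolutionOfSingularities.ResolutionOfSingularities.Theorems.SwitchingDichotomy.ToricUnitExit

end
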